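import Mathlib
import Literature.Computability.Complexity.SignDegreeSimple

/-!
# Integer margin-1 certificates from sign-degree, with a uniform weight bound per `(k, d)`
# (pnp-ideate-p3 ROUND-17, F-N2 item K2 in abstract form)

`SignDegLE d P` (a rational degree-≤d polynomial strictly sign-representing `P`,
`Literature.Computability.Complexity.SignDegLE`) yields an INTEGER degree-≤d polynomial with margin `≥ 1`
(scale by the minimal margin, clear denominators), and since there are finitely many tables on `k` bits,
ONE weight bound `W` serves every table of sign-degree `≤ d` — the finite «margin table» that the
linear-stretch algorithms (F-N2a: d = 1, F-N2: d = 2) consume.  FRONTIER; nothing here bears on P vs NP.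
-/

namespace Summit.PneNP.PneNP.Theorems.SignDegIntCert

open Literature.Computability.Complexity Finset

variable {k : ℕ}

/-- An integer degree-≤`d` certificate of margin `1` and total weight `≤ W` for the table `P` (data). -/
structure IntCert (d : ℕ) (W : ℤ) (P : (Fin k → Bool) → Bool) where
  /-- integer coefficients on the sets `S` -/
  cz : Finset (Fin k) → ℤ
  /-- supported on sets of size `≤ d` -/
  high : ∀ S, d < S.card → cz S = 0
  /-- total weight bound -/
  weight : ∑ S, |cz S| ≤ W
  /-- margin-1 sign-representation -/
  valid : ∀ u : Fin k → Bool, 1 ≤ bsgn (P u) * ∑ S : Finset (Fin k), (cz S : ℚ) * chiQ S u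

/-- A finite family of rationals has a common denominator. -/
lemma exists_common_den {ι : Type*} [Fintype ι] [DecidableEq ι] (q : ι → ℚ) :
    ∃ D : ℕ, 0 < D ∧ ∀ i, ∃ z : ℤ, q i * D = z := by
  refine ⟨∏ i, (q i).den, Finset.prod_pos fun i _ => (q i).den_pos, fun i => ?_⟩
  refine ⟨(q i).num * ∏ j ∈ Finset.univ.erase i, ((q j).den : ℤ), ?_⟩
  rw [← Finset.mul_prod_erase Finset.univ (fun j => (q j).den) (Finset.mem_univ i)]
  push_cast
  rw [← mul_assoc, Rat.mul_den_eq_num]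

/-- **Integer certificate with margin 1** from a strict rational sign-representation. -/
theorem exists_intCert_of_signDegLE {d : ℕ} {P : (Fin k → Bool) → Bool} (h : SignDegLE d P) :
    ∃ W : ℤ, Nonempty (IntCert d W P) := by
  classical
  obtain ⟨c, hc0, hpos⟩ := h
  -- minimal margin τ > 0
  have hne : (Finset.univ : Finset (Fin k → Bool)).Nonempty := Finset.univ_nonempty
  set τ : ℚ := Finset.univ.inf' hne (fun u => bsgn (P u) * ∑ S, c S * chiQ S u) with hτ
  have hτpos : 0 < τ := by
    rw [hτ, Finset.lt_inf'_iff]; intro u _; exact hpos u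
  have hτle : ∀ u, τ ≤ bsgn (P u) * ∑ S, c S * chiQ S u := fun u => Finset.inf'_le _ (Finset.mem_univ u)
  -- common denominator of c S / τ
  obtain ⟨D, hDpos, hD⟩ := exists_common_den (fun S : Finset (Fin k) => c S / τ)
  choose z hz using hD
  refine ⟨∑ S, |z S|, ⟨⟨z, ?_, le_rfl, ?_⟩⟩⟩
  · intro S hS
    have := hz S
    rw [hc0 S hS, zero_div, zero_mul] at this
    exact_mod_cast this.symm
  · intro u
    have hzq : ∀ S, (z S : ℚ) = c S / τ * D := fun S => (hz S).symm
    simp_rw [hzq]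
    have hsum : ∑ S : Finset (Fin k), c S / τ * D * chiQ S u = (D / τ) * ∑ S, c S * chiQ S u := by
      rw [Finset.mul_sum]; refine Finset.sum_congr rfl fun S _ => by ring
    rw [hsum, ← mul_assoc, mul_comm (bsgn (P u)) (D / τ), mul_assoc]
    have hD1 : (1 : ℚ) ≤ D := by exact_mod_cast hDpos
    have h1 : 1 ≤ (D : ℚ) / τ * τ := by rw [div_mul_cancel₀ _ hτpos.ne']; exact hD1
    calc (1 : ℚ) ≤ (D : ℚ) / τ * τ := h1
      _ ≤ (D : ℚ) / τ * (bsgn (P u) * ∑ S, c S * chiQ S u) :=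
          mul_le_mul_of_nonneg_left (hτle u) (div_nonneg (by positivity) hτpos.le)

/-- `IntCert` is monotone in the weight bound. -/
def IntCert.mono {d : ℕ} {W W' : ℤ} {P : (Fin k → Bool) → Bool} (h : IntCert d W P) (hW : W ≤ W') :
    IntCert d W' P :=
  ⟨h.cz, h.high, h.weight.trans hW, h.valid⟩

/-- **Uniform margin table**: for fixed `k` and `d` ONE weight bound serves every `k`-bit table of
sign-degree `≤ d`. -/
theorem exists_uniform_intCert (k d : ℕ) :
    ∃ W : ℤ, 0 ≤ W ∧ ∀ P : (Fin k → Bool) → Bool, SignDegLE d P → Nonempty (IntCert d W P) := by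
  classical
  -- per-table weight (0 if the table is not of sign-degree ≤ d)
  let w : ((Fin k → Bool) → Bool) → ℤ := fun P =>
    if h : SignDegLE d P then max 0 (Classical.choose (exists_intCert_of_signDegLE h)) else 0
  have hw0 : ∀ P, 0 ≤ w P := fun P => by
    simp only [w]; split_ifs <;> simp
  refine ⟨∑ P, w P, Finset.sum_nonneg fun P _ => hw0 P, fun P hP => ?_⟩
  have hle : w P ≤ ∑ P', w P' := Finset.single_le_sum (fun P' _ => hw0 P') (Finset.mem_univ P)
  have hcert : Nonempty (IntCert d (w P) P) := by
    obtain ⟨c⟩ := Classical.choose_spec (exists_intCert_of_signDegLE hP)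
    simp only [w, dif_pos hP]
    exact ⟨c.mono (le_max_right _ _)⟩
  obtain ⟨c⟩ := hcert
  exact ⟨c.mono hle⟩

end Summit.PneNP.PneNP.Theorems.SignDegIntCert
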